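/-
HarnessLib.Audit.Tags — obligation-graph tag attributes (D-0027 §2.1 native audit). Imports `Lean` only (cheap
enough for a Statement.lean to import directly). Kept apart from `HarnessLib.Audit` because attributes/extensions
registered with `initialize` are usable only from an importing module. Like `HarnessLib.Audit`, NOT part of the
generated root `HarnessLib.lean` (see there).
-/
import Lean

/-!
# Obligation-graph tags (D-0027 §2.1)

Attributes that RECORD which declarations play which role in a summit's obligation tree. They check
nothing by themselves; `#h21_check_closes` / `#h21_tree_audit` (module `HarnessLib.Audit`) read them.

* `@[summit_statement]` — the decl is a (sub-)problem `Statement` (the parent every route glue must conclude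
  BY NAME). Also applicable after the fact: `attribute [summit_statement] Summit.PneNP` (the gate writes that
  line into every route file, resolved from the registry).
* `@[route_item "route-id"]` / `@[route_item "route-id" "crux"]` — a listed item of route `route-id`, optionally with
  its LEDGER KIND (`crux` | `support` | `target` | `assembly`); items are the only admissible hypotheses of that route's
  `closes` theorem, and (human ruling 2026-08-16) only `crux` items may appear there. The kind is recorded as a second
  entry `(decl, route_item_kind, kind)` so the extension's entry layout — and every olean already carrying tags — is unchanged.
* `@[route_premise "route-id"]` — the named conjecture of a `--conditional-bridge` route (an admissible
  hypothesis that is not an item; usually `attribute [route_premise "r"] _root_.SomeConjecture`).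
* `@[closes "route-id"]` — THE deciding theorem of the route: `items → Statement` (or `items → ¬ Statement`
  for a refutation route).
* `@[refutes]` — a negative edge `theorem t : ¬ D` (D an item / statement / stub, by name).
* `@[stub "line-id"]` — a declared stub of a Line skeleton (D-0027 §3.3).
* `@[conjecture]` — an OPEN named conjecture stated in our theories (`def <Name> : Prop := …` under
  `Summits/<S>/<Sub>/Theorems/`, `[cite]`d to where it was stated; human rule 2026-08-15): an obligation node —
  provable / refutable by name, never a vendored fact; a route may depend on it only as its own item / premise.

Every application records `(decl, attr, arg)`; entries arriving through `import` are stamped with the index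
of the module that APPLIED them (unforgeable by the applying module), so the audit can tell a tag written by
the gate into the route file from one smuggled in through an imported file.
-/

open Lean

namespace HarnessLib.Audit

/-- One recorded obligation tag. -/
structure TagRec where
  decl : Name
  attr : Name
  arg  : String := ""
  deriving Inhabited, Repr, BEq

/-- Extension state: every tag with the index of the module that applied it (`none` = the current module). -/
structure TagState where
  recs : Array (TagRec × Option Nat) := #[]
  deriving Inhabited

initialize auditTagExt : SimplePersistentEnvExtension TagRec TagState ←
  registerSimplePersistentEnvExtension {
    addEntryFn := fun s r => { s with recs := s.recs.push (r, none) }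
    addImportedFn := fun arrs => Id.run do
      let mut recs : Array (TagRec × Option Nat) := #[]
      for h : i in [0:arrs.size] do
        for r in arrs[i] do
          recs := recs.push (r, some i)
      return { recs }
  }

/-- A tag as the audit sees it: `origin` = module that applied it (`none` = this file). -/
structure Tag where
  decl   : Name
  attr   : Name
  arg    : String
  origin : Option Name
  deriving Inhabited, Repr, BEq

/-- Name of the imported module with index `i` (O(1); `EnvironmentHeader.moduleNames` rebuilds the whole array per call). -/
def moduleName? (env : Environment) (i : Nat) : Option Name :=
  (env.header.modules[i]?).map (·.module)

/-- All obligation tags in `env` (imported first, then local), origins resolved to module names. -/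
def allTags (env : Environment) : Array Tag :=
  (auditTagExt.getState env).recs.map fun (r, oi) =>
    { decl := r.decl, attr := r.attr, arg := r.arg,
      origin := oi.map fun i => (moduleName? env i).getD `_unknown }

/-- Tags recorded for one declaration. -/
def tagsOfDecl (env : Environment) (n : Name) : Array Tag :=
  (allTags env).filter (·.decl == n)

/-- `@[summit_statement]` — (sub-)problem statement decl. -/
syntax (name := summit_statement) "summit_statement" : attr
/-- `@[route_item "route-id"]` or `@[route_item "route-id" "kind"]` — listed item of a route (kind = ledger kind). -/
syntax (name := route_item) "route_item " str (ppSpace str)? : attr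
/-- `@[route_premise "route-id"]` — named conjecture of a conditional-bridge route. -/
syntax (name := route_premise) "route_premise " str : attr
/-- `@[closes "route-id"]` — the route's deciding theorem. -/
syntax (name := closes) "closes " str : attr
/-- `@[refutes]` — negative edge `¬ D`. -/
syntax (name := refutes) "refutes" : attr
/-- `@[stub "line-id"]` — declared stub of a Line skeleton. -/
syntax (name := stub) "stub " str : attr
/-- `@[conjecture]` — open named conjecture stated in our theories (an obligation node). -/
syntax (name := conjecture) "conjecture" : attr

private def record (decl attr : Name) (arg : String) (kind : AttributeKind) : AttrM Unit := do
  unless kind == AttributeKind.global do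
    throwError "obligation tags are global only (no `local`/`scoped`)"
  modifyEnv fun env => auditTagExt.addEntry env { decl, attr, arg }

initialize registerBuiltinAttribute {
  name := `summit_statement
  descr := "(sub-)problem Statement decl of the obligation graph"
  applicationTime := .afterTypeChecking
  add := fun decl _stx kind => record decl `summit_statement "" kind
}

initialize registerBuiltinAttribute {
  name := `route_item
  descr := "listed item of a route: @[route_item \"route-id\"]"
  applicationTime := .afterTypeChecking
  add := fun decl stx kind => do
    match stx with
    | `(attr| route_item $r:str $[$k:str]?) =>
      record decl `route_item r.getString kind
      if let some k := k then record decl `route_item_kind k.getString kind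
    | _ => throwError "malformed @[route_item]: expected @[route_item \"route-id\"] or @[route_item \"route-id\" \"kind\"]"
}

initialize registerBuiltinAttribute {
  name := `route_premise
  descr := "named conjecture of a conditional-bridge route: @[route_premise \"route-id\"]"
  applicationTime := .afterTypeChecking
  add := fun decl stx kind => do
    match stx with
    | `(attr| route_premise $r:str) => record decl `route_premise r.getString kind
    | _ => throwError "malformed @[route_premise]: expected @[route_premise \"route-id\"]"
}

initialize registerBuiltinAttribute {
  name := `closes
  descr := "deciding theorem of a route: @[closes \"route-id\"]"
  applicationTime := .afterTypeChecking
  add := fun decl stx kind => do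
    match stx with
    | `(attr| closes $r:str) => record decl `closes r.getString kind
    | _ => throwError "malformed @[closes]: expected @[closes \"route-id\"]"
}

initialize registerBuiltinAttribute {
  name := `refutes
  descr := "negative edge: theorem of type ¬ D"
  applicationTime := .afterTypeChecking
  add := fun decl _stx kind => record decl `refutes "" kind
}

initialize registerBuiltinAttribute {
  name := `stub
  descr := "declared stub of a Line skeleton: @[stub \"line-id\"]"
  applicationTime := .afterTypeChecking
  add := fun decl stx kind => do
    match stx with
    | `(attr| stub $l:str) => record decl `stub l.getString kind
    | _ => throwError "malformed @[stub]: expected @[stub \"line-id\"]"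
}

initialize registerBuiltinAttribute {
  name := `conjecture
  descr := "open named conjecture stated in our theories (obligation node)"
  applicationTime := .afterTypeChecking
  add := fun decl _stx kind => record decl `conjecture "" kind
}

end HarnessLib.Audit
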